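import Mathlib.Combinatorics.HalesJewett
import Mathlib.Data.Fintype.Pi
import Mathlib.Data.Finset.Max
import Literature.Combinatorics.HalesJewett.SubspaceToolkit
import HarnessLib

/-!
# Colourings of combinatorial lines, I: reduction to prefix-determined colourings

Topic `Literature/Combinatorics/HalesJewett`. First of three files (`GrahamRothschildPrefix`,
`GrahamRothschildLevel`, `GrahamRothschildLines`) proving, from Mathlib's Hales–Jewett theorem,
the following consequence of the Graham–Rothschild theorem on parameter sets used by P. Dodos,
V. Kanellopoulos, K. Tyros, *A simple proof of the density Hales–Jewett
theorem*, IMRN 2014, Proposition 2: *for all `k ≥ 2`, `m ≥ 1` there is `N` such that for every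
`n ≥ N` and every set `𝓛` of combinatorial lines of `[k]^n` there is an `m`-dimensional subspace
`V` of `[k]^n` with `Lines(V) ⊆ 𝓛` or `Lines(V) ∩ 𝓛 = ∅`* (equivalently: every finite colouring
of the lines of `[k]^n` is constant on the lines of some `m`-dimensional subspace). DKT quote it
from R. L. Graham, B. L. Rothschild, Trans. AMS 159 (1971) and remark that it "can be proved by
repeated applications of the Hales–Jewett theorem"; the proof in these three files is such a direct
argument in three stages, of which this file is the first (the directory also holds the port
`GrahamRothschild.lean` of G. Dahia's development — `GrahamRothschild.exists_lines`, via the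
finite-unions theorem and support canonization — and `DKTGrahamRothschild.lean`, the named fact
`GrahamRothschildLines` with Prömel's proof; three renderings of the same statement):

* **Stage I** (`exists_subspace_prefixDetermined`): for every `m` and all large cubes `ι → α`,
  every colouring `c` of the lines of `ι → α` admits an `m`-dimensional subspace `Z` (variables
  indexed by `Fin m`) such that the colour of the line `Z.line l`, `l` a line of the parameter cube
  `Fin m → α`, depends only on the *position `p` of the first variable letter of `l` and the letters
  of `l` before `p`* (`PrefixDetermined`). Proof by induction on `m`: the multidimensional
  Hales–Jewett theorem over the alphabet `Option α` (variable words as honest words, one extra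
  letter), applied to `c` extended by a dummy colour on words without the variable letter, yields a
  subspace `z̃` all of whose points are variable words of one colour; `z̃` must have a constant
  coordinate equal to the variable letter, and these coordinates form the new first variable of
  `Z`; the induction hypothesis with colours `α → κ` handles the lines whose first letter is honest.

Stage II (nested multidimensional Hales–Jewett on prefixes: `exists_subspace_levelDetermined`) is
`GrahamRothschildLevel.lean`; Stage III (pigeonhole over the position of the first variable:
`exists_subspace_lines_mono`, DKT Prop. 2) is `GrahamRothschildLines.lean`.

## References
* P. Dodos, V. Kanellopoulos, K. Tyros, IMRN 2014 (12), 3340–3352, Proposition 2.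
  [cite: DodosKanellopoulosTyros2014]
* R. L. Graham, B. L. Rothschild, *Ramsey's theorem for `n`-parameter sets*, Trans. AMS 159
  (1971), 257–292.
* A. W. Hales, R. I. Jewett, Trans. AMS 106 (1963), 222–229.
-/

namespace Literature.Combinatorics.HalesJewett

open _root_.Combinatorics

variable {α η ι κ : Type*}

/-- A colouring `c` of the lines of a cube `η → α` over an ordered index set is
**prefix-determined** if `c l` depends only on the position `p` of the first variable coordinate
of `l` and on the (honest) letters of `l` before `p`. [folklore] -/
def PrefixDetermined [LT η] (c : Line α η → κ) : Prop :=
  ∀ (l l' : Line α η) (p : η), l.idxFun p = none → l'.idxFun p = none →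
    (∀ e, e < p → l.idxFun e ≠ none ∧ l.idxFun e = l'.idxFun e) → c l = c l'

/-- A colouring `c` of the lines of a cube `η → α` over an ordered index set is
**level-determined** if `c l` depends only on the position of the first variable coordinate of
`l`. [folklore] -/
def LevelDetermined [LT η] (c : Line α η → κ) : Prop :=
  ∀ (l l' : Line α η) (p : η), l.idxFun p = none → l'.idxFun p = none →
    (∀ e, e < p → l.idxFun e ≠ none ∧ l'.idxFun e ≠ none) → c l = c l'

/-- Every variable word over a finite linearly ordered index set has a first variable
coordinate. [folklore] -/
theorem exists_first_none [LinearOrder η] [Fintype η] (w : η → Option α) (h : ∃ e, w e = none) :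
    ∃ p, w p = none ∧ ∀ e, e < p → w e ≠ none := by
  classical
  set s : Finset η := Finset.univ.filter fun e => w e = none with hs
  have hne : s.Nonempty := by
    obtain ⟨e, he⟩ := h
    exact ⟨e, by simp [hs, he]⟩
  refine ⟨s.min' hne, ?_, fun e he hwe => ?_⟩
  · have := Finset.min'_mem s hne
    simp only [hs, Finset.mem_filter, Finset.mem_univ, true_and] at this
    exact this
  · have : s.min' hne ≤ e := Finset.min'_le s e (by simp [hs, hwe])
    exact absurd he (not_lt.2 this)

namespace GrahamRothschild

/-!
### Stage I: the construction

Throughout, `z : Subspace θ (Option α) ι` is a subspace over the extended alphabet (from the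
multidimensional Hales–Jewett theorem) and `y : Subspace (Fin m) α θ` a subspace of its parameter
cube (from the induction hypothesis).
-/

variable {θ : Type*} {m : ℕ}

/-- The line of `ι → α` "first letter `b`, then the variable word `w` of the parameter cube of
`z`": constant-`none` coordinates of `z` receive `b`, constant-`some a` coordinates `a`, variable
coordinates the entries of `w`. [folklore] -/
def consLine (z : Subspace θ (Option α) ι) (b : α) (l : Line α θ) : Line α ι where
  idxFun i := (z.idxFun i).elim (fun o => o.elim (some b) some) l.idxFun
  proper := by
    obtain ⟨e, he⟩ := l.proper
    obtain ⟨i, hi⟩ := z.proper e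
    exact ⟨i, by simp [hi, he]⟩

/-- The `(m+1)`-variable word assembled from `z` and `y`: the constant-`none` coordinates of `z`
become the new variable `0`, the variables of `z` are substituted by `y` (variables shifted by
`Fin.succ`). It is a subspace as soon as `z` has a constant-`none` coordinate. [folklore] -/
def consSubspace (z : Subspace θ (Option α) ι) (y : Subspace (Fin m) α θ)
    (h0 : ∃ i, z.idxFun i = Sum.inl none) : Subspace (Fin (m + 1)) α ι where
  idxFun i := (z.idxFun i).elim (fun o => o.elim (Sum.inr 0) Sum.inl)
    fun e => (y.idxFun e).map id Fin.succ
  proper j := by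
    induction j using Fin.cases with
    | zero =>
      obtain ⟨i, hi⟩ := h0
      exact ⟨i, by simp [hi]⟩
    | succ j =>
      obtain ⟨e, he⟩ := y.proper j
      obtain ⟨i, hi⟩ := z.proper e
      exact ⟨i, by simp [hi, he]⟩

/-- The tail of a line of `Fin (m+1) → α` whose coordinate `0` is honest. [folklore] -/
def tailLine (l : Line α (Fin (m + 1))) (h : l.idxFun 0 ≠ none) : Line α (Fin m) where
  idxFun := l.idxFun ∘ Fin.succ
  proper := by
    obtain ⟨j, hj⟩ := l.proper
    induction j using Fin.cases with
    | zero => exact absurd hj h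
    | succ j => exact ⟨j, hj⟩

/-- Lines of `consSubspace z y` whose variable `0` is used are points of `z` (as words over
`Option α`): `(consSubspace z y h0).pat w = z (y.pat (w ∘ Fin.succ))` when `w 0 = none`.
[folklore] -/
theorem consSubspace_pat_of_zero {z : Subspace θ (Option α) ι} {y : Subspace (Fin m) α θ}
    (h0 : ∃ i, z.idxFun i = Sum.inl none) (w : Fin (m + 1) → Option α) (hw : w 0 = none) :
    (consSubspace z y h0).pat w = z (y.pat (w ∘ Fin.succ)) := by
  funext i
  rcases hz : z.idxFun i with (_ | a) | e
  · simp [Subspace.pat, consSubspace, Subspace.coe_apply, hz, hw]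
  · simp [Subspace.pat, consSubspace, Subspace.coe_apply, hz]
  · rcases hy : y.idxFun e with a | j
    · simp [Subspace.pat, consSubspace, Subspace.coe_apply, hz, hy]
    · simp [Subspace.pat, consSubspace, Subspace.coe_apply, hz, hy]

/-- Lines of `consSubspace z y` whose coordinate `0` is the honest letter `b` are the lines
`consLine z b (y.line (tail))`. [folklore] -/
theorem consSubspace_line_of_some {z : Subspace θ (Option α) ι} {y : Subspace (Fin m) α θ}
    (h0 : ∃ i, z.idxFun i = Sum.inl none) (l : Line α (Fin (m + 1))) {b : α}
    (hb : l.idxFun 0 = some b) :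
    (consSubspace z y h0).line l = consLine z b (y.line (tailLine l (by simp [hb]))) := by
  refine Line.ext ?_
  funext i
  change (consSubspace z y h0).pat l.idxFun i = _
  rcases hz : z.idxFun i with (_ | a) | e
  · simp [Subspace.pat, consSubspace, consLine, hz, hb]
  · simp [Subspace.pat, consSubspace, consLine, hz]
  · rcases hy : y.idxFun e with a | j
    · simp [Subspace.pat, consSubspace, consLine, tailLine, Subspace.line, hz, hy]
    · simp [Subspace.pat, consSubspace, consLine, tailLine, Subspace.line, hz, hy]

/-- The extension of a colouring of lines to all words over `Option α`: honest words get the dummy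
colour `none`. [folklore] -/
noncomputable def extColouring (c : Line α ι → κ) (w : ι → Option α) : Option κ :=
  open scoped Classical in
  if h : ∃ i, w i = none then some (c ⟨w, h⟩) else none

/-- On variable words the extended colouring is the colour of the line. [folklore] -/
theorem extColouring_line (c : Line α ι → κ) (l : Line α ι) :
    extColouring c l.idxFun = some (c l) := by
  unfold extColouring
  rw [dif_pos l.proper]

/-- A subspace over `Option α` (with at least one variable) all of whose points have the same
extended colour has a constant coordinate equal to `none`: compare an honest point with the
all-variable point. [folklore] -/
theorem exists_inl_none_of_isMono [Nonempty α] [Nonempty θ] {c : Line α ι → κ}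
    {z : Subspace θ (Option α) ι} (hz : z.IsMono (extColouring c)) :
    ∃ i, z.idxFun i = Sum.inl none := by
  classical
  obtain ⟨k₀, hk⟩ := hz
  obtain ⟨a₀⟩ := ‹Nonempty α›
  obtain ⟨e₀⟩ := ‹Nonempty θ›
  -- the all-variable point is a variable word, so `k₀ = some _`
  have h1 : ∃ i, z (fun _ => none) i = none := by
    obtain ⟨i, hi⟩ := z.proper e₀
    exact ⟨i, by simp [Subspace.coe_apply, hi]⟩
  have hk₀ : k₀.isSome := by
    rw [← hk fun _ => none, extColouring, dif_pos h1]; rfl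
  -- hence the honest point `z (fun _ ↦ some a₀)` has a `none` coordinate
  have h2 : ∃ i, z (fun _ => some a₀) i = none := by
    by_contra h
    have := hk fun _ => some a₀
    rw [extColouring, dif_neg h] at this
    rw [← this] at hk₀
    exact Bool.false_ne_true hk₀
  obtain ⟨i, hi⟩ := h2
  refine ⟨i, ?_⟩
  rcases hzi : z.idxFun i with (_ | a) | e
  · rfl
  · simp [Subspace.coe_apply, hzi] at hi
  · simp [Subspace.coe_apply, hzi] at hi

end GrahamRothschild

open GrahamRothschild in
/-- **Stage I.** For every `m`, every finite set of colours `κ` and all large finite cubes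
`ι → α` (`α` finite, nonempty): every colouring of the lines of `ι → α` is prefix-determined on
the lines of some `m`-dimensional subspace. Induction on `m` via the multidimensional Hales–Jewett
theorem over `Option α` and the induction hypothesis with colours `α → κ` (module docstring).
[cite: DodosKanellopoulosTyros2014, Proposition 2 (proof, first stage)] -/
theorem exists_subspace_prefixDetermined (α : Type) [Fintype α] [Nonempty α] [DecidableEq α]
    (m : ℕ) : ∀ (κ : Type) [Fintype κ], ∃ N : ℕ, ∀ (ι : Type) [Fintype ι],
      N ≤ Fintype.card ι → ∀ c : Line α ι → κ,
        ∃ Z : Subspace (Fin m) α ι, PrefixDetermined fun l => c (Z.line l) := by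
  induction m with
  | zero =>
    intro κ _
    refine ⟨0, fun ι _ _ c => ?_⟩
    obtain ⟨a₀⟩ := ‹Nonempty α›
    refine ⟨⟨fun _ => Sum.inl a₀, fun e => e.elim0⟩, fun l => ?_⟩
    exact l.proper.choose.elim0
  | succ m ih =>
    intro κ _
    -- colours `α → κ` for the induction hypothesis, in dimension `Fin (N' + 1)`
    obtain ⟨N', hN'⟩ := ih (α → κ)
    obtain ⟨N, hN⟩ := exists_mono_subspace_of_card_le (Option α) (Option κ) (Fin (N' + 1))
    refine ⟨N, fun ι _ hι c => ?_⟩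
    -- multidimensional Hales–Jewett over `Option α` for the extended colouring
    obtain ⟨z, hz⟩ := hN ι hι (extColouring c)
    have h0 : ∃ i, z.idxFun i = Sum.inl none := exists_inl_none_of_isMono hz
    obtain ⟨k₀, hk⟩ := hz
    -- induction hypothesis in the parameter cube of `z`, colours `b ↦ c (consLine z b ·)`
    obtain ⟨y, hy⟩ := hN' (Fin (N' + 1)) (by simp) fun l' b => c (consLine z b l')
    refine ⟨consSubspace z y h0, fun l₁ l₂ p hp₁ hp₂ hlt => ?_⟩
    induction p using Fin.cases with
    | zero =>
      -- both lines use the variable `0`: both are points of `z`, colour `k₀`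
      have key : ∀ l : Line α (Fin (m + 1)), l.idxFun 0 = none →
          some (c ((consSubspace z y h0).line l)) = k₀ := fun l hl => by
        rw [← extColouring_line, Subspace.line_idxFun, consSubspace_pat_of_zero h0 _ hl]
        exact hk _
      exact Option.some_injective _ ((key l₁ hp₁).trans (key l₂ hp₂).symm)
    | succ p =>
      -- both lines start with the same honest letter `b`
      obtain ⟨h1, h12⟩ := hlt 0 (Fin.succ_pos p)
      obtain ⟨b, hb₁⟩ := Option.ne_none_iff_exists'.1 h1
      have hb₂ : l₂.idxFun 0 = some b := h12 ▸ hb₁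
      simp only
      rw [consSubspace_line_of_some h0 l₁ hb₁, consSubspace_line_of_some h0 l₂ hb₂]
      have := hy (tailLine l₁ (by simp [hb₁])) (tailLine l₂ (by simp [hb₂])) p hp₁ hp₂
        fun e he => hlt e.succ (Fin.succ_lt_succ_iff.2 he)
      exact congr_fun this b

end Literature.Combinatorics.HalesJewett
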